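import Literature.AlgebraicGeometry.Resolution.ArithmeticalThreefoldsLocalDescentInertiaClimb
import HarnessLib

/-!
# The inertia layer of [CoP1] Prop. 9.3 from a local uniformization of `Mⁱ` with STABLE LOCAL RING

Topic: `Literature/AlgebraicGeometry/Resolution`. PROOF side of `CossartPiltant2019ReductionP`
(`ArithmeticalThreefoldsLocal.lean`), input (C4), inertia layer of [CoP1] Prop. 9.3.
`cossartPiltant2019ReductionP_of_cjs_of_stableInertiaField`
(`ArithmeticalThreefoldsLocalDescentInertiaClimb.lean`) asks (`hStabI`) for a local
uniformization of the inertia field `Mⁱ` whose finite GENERATING SET is permuted by `Gˢ`. The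
printed sentence is about the LOCAL RING ("`S₀ⁱ` … the invariant ring `S₀ˢ := (S₀ⁱ)^{Gˢ/Gⁱ}`",
HAL p. 27; "`S` is stable by `G`", p. 29): as for the tame layer
(`ArithmeticalThreefoldsLocalDescentKummerStableLocalRing.lean`), the weaker printed form
suffices — if the local ring `(S[t])_𝔪` of a local uniformization of `Mⁱ` (`t ⊆ Mⁱ`) is
`Gˢ`-stable, the orbit `Gˢ·t ⊆ Mⁱ` generates a `Gˢ`-stable model with the SAME local ring
(sandwich `S[t] ⊆ S[Gˢ·t] ⊆ (S[t])_𝔪`), fixed pointwise by `Gⁱ` (which is normal in `Gˢ` and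
fixes `Mⁱ`); and "trivial inertia of `Gˢ/Gⁱ` on the model" reads: every `τ ∈ Gˢ ∖ Gⁱ` moves some
element of `(S[t])_𝔪` by a `v`-unit.

* `exists_stableModel_of_stableLocalRing_decompositionGroup` — PROVED: the conversion from a
  local uniformization of `Mⁱ` with `Gˢ`-stable local ring and `Gˢ/Gⁱ` residually faithful on it
  to the `Gˢ`-stable generating data of `exists_model_decompositionField_of_stableModel`;
* `cossartPiltant2019ReductionP_of_cjs_of_stableInertiaLocalRing` — PROVED:
  `CossartPiltant2019Local → CossartPiltant2019Principalization → CossartJannsenSaito2020General →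
  (embedded resolution of surfaces) → (hStabLoc: tame layer, "S is stable by G") →
  (hStabIloc: inertia layer, "(S[t])_𝔪 is stable by Gˢ and Gˢ/Gⁱ acts on it with trivial
  inertia") → (hDec) → CossartPiltant2019ReductionP`.

Everything is PROVED; no named facts, definitions, instances or notation are introduced.

## Sources

* V. Cossart, O. Piltant, J. Algebra 320 (2008) 1051–1082: proof of Prop. 9.3 (HAL
  hal-00139124, p. 27), proof of Lemma 9.4 (p. 29, l. 16). [CossartPiltant2008]
* V. Cossart, O. Piltant, J. Algebra 529 (2019) 268–535 = arXiv:1412.0868, proof of Prop. 4.10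
  (arXiv v1: Prop. 4.8, p. 54). [CossartPiltant2019]
-/

noncomputable section

open CategoryTheory AlgebraicGeometry TopologicalSpace IsLocalRing _root_.Polynomial
  _root_.IntermediateField

namespace Literature.AlgebraicGeometry.Resolution

universe u

section InertiaStableLocalRing

variable {S E : Type u} [CommRing S] [Field E] [Algebra S E]

/-- **From a `Gˢ`-stable LOCAL RING to a `Gˢ`-stable model, inertia layer** ("`S` is stable by
`G`", read on the local ring `(S[t])_𝔪`): for `N | M` finite inside `E`, a model `S[t] ⊆ O_E`
with `t ⊆ Mⁱ` regular at the centre, whose local ring at the centre of `O_E` is stable under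
`Gˢ = decompositionGroupIn O_E N` and on which every `τ ∈ Gˢ ∖ Gⁱ` moves some element by a
`v`-unit, the orbit `Gˢ·t ⊆ N` generates a `Gˢ`-stable model with the same local ring (hence
regular at the centre), fixed pointwise by `Gⁱ` (normal in `Gˢ`, fixing `Mⁱ ∋ t`).
[cite: CossartPiltant2008, proof of Prop. 9.3 (HAL p. 27) and of Lemma 9.4 (p. 29, l. 16)] -/
theorem exists_stableModel_of_stableLocalRing_decompositionGroup (OE : ValuationSubring E)
    (M : Subfield E) (N : IntermediateField M E) [FiniteDimensional M N]
    (t : Finset E) (htI : (t : Set E) ⊆ (lift (fixedField (inertiaGroupIn OE N))).toSubfield)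
    (X : Subfield E) (hXcl : X ≤ Subfield.closure (Set.range (algebraMap S E) ∪ (t : Set E)))
    (hTO : (Algebra.adjoin S (t : Set E)).toSubring ≤ OE.toSubring)
    (hreg : IsRegularLocalRing (Localization.AtPrime
      (Ideal.comap (Subring.inclusion hTO) (maximalIdeal OE))))
    (hstab : ∀ τ ∈ decompositionGroupIn OE N, ∀ x : N,
      (x : E) ∈ locAtCentre (Algebra.adjoin S (t : Set E)).toSubring OE →
      ((τ x : N) : E) ∈ locAtCentre (Algebra.adjoin S (t : Set E)).toSubring OE)
    (hI : ∀ τ ∈ decompositionGroupIn OE N, τ ∈ inertiaGroupIn OE N ∨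
      ∃ x : N, (x : E) ∈ locAtCentre (Algebra.adjoin S (t : Set E)).toSubring OE ∧
        OE.valuation (((τ x : N) : E) - x) = 1) :
    ∃ t' : Finset E, (t' : Set E) ⊆ N.toSubfield ∧
      X ≤ Subfield.closure (Set.range (algebraMap S E) ∪ (t' : Set E)) ∧
      ∃ hTO' : (Algebra.adjoin S (t' : Set E)).toSubring ≤ OE.toSubring,
        IsRegularLocalRing (Localization.AtPrime
          (Ideal.comap (Subring.inclusion hTO') (maximalIdeal OE))) ∧
        (∀ τ ∈ decompositionGroupIn OE N, ∀ x : N, (x : E) ∈ t' → ((τ x : N) : E) ∈ t') ∧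
        (∀ τ ∈ decompositionGroupIn OE N, (∀ x : N, (x : E) ∈ t' → τ x = x) ∨
          ∃ x : N, (x : E) ∈ locAtCentre (Algebra.adjoin S (t' : Set E)).toSubring OE ∧
            OE.valuation (((τ x : N) : E) - x) = 1) := by
  classical
  have htN' : ∀ x ∈ t, x ∈ N := fun x hx =>
    lift_le _ (show x ∈ lift (fixedField (inertiaGroupIn OE N)) from htI (Finset.mem_coe.mpr hx))
  have htfix : ∀ x ∈ t, ∀ σ ∈ inertiaGroupIn OE N, ∀ (hx : x ∈ N), σ ⟨x, hx⟩ = ⟨x, hx⟩ := by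
    intro x hxt σ hσ hx
    have h1 : (⟨x, hx⟩ : N) ∈ fixedField (inertiaGroupIn OE N) :=
      (IntermediateField.mem_lift (⟨x, hx⟩ : N)).mp (htI (Finset.mem_coe.mpr hxt))
    exact (mem_fixedField_iff _ _).mp h1 σ hσ
  let G := ↥(decompositionGroupIn OE N)
  letI : Fintype G := Fintype.ofFinite G
  let t₀ : Finset N := t.subtype (· ∈ N)
  have ht₀ : ∀ y : N, y ∈ t₀ ↔ (y : E) ∈ t := fun y => Finset.mem_subtype
  -- the orbit `Gˢ·t`
  let t' : Finset E :=
    (Finset.univ : Finset G).biUnion fun g => t₀.image fun y => ((g.1 y : N) : E)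
  have ht' : ∀ x : E, x ∈ t' ↔ ∃ (g : G) (y : N), (y : E) ∈ t ∧ ((g.1 y : N) : E) = x := by
    intro x
    simp only [t', Finset.mem_biUnion, Finset.mem_univ, true_and, Finset.mem_image]
    constructor
    · rintro ⟨g, y, hy, rfl⟩
      exact ⟨g, y, (ht₀ y).mp hy, rfl⟩
    · rintro ⟨g, y, hy, rfl⟩
      exact ⟨g, y, (ht₀ y).mpr hy, rfl⟩
  have htt' : t ⊆ t' := by
    intro x hx
    exact (ht' x).mpr ⟨1, ⟨x, htN' x hx⟩, hx, rfl⟩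
  set L := locAtCentre (Algebra.adjoin S (t : Set E)).toSubring OE with hL
  have hLO : L ≤ OE.toSubring := locAtCentre_le hTO
  have htL : ∀ x ∈ t, x ∈ L := fun x hx =>
    le_locAtCentre _ OE (Algebra.subset_adjoin (Finset.mem_coe.mpr hx))
  have ht'L : ∀ x ∈ t', x ∈ L := by
    intro x hx
    obtain ⟨g, y, hy, rfl⟩ := (ht' x).mp hx
    exact hstab g.1 g.2 y (htL _ hy)
  -- the sandwich `S[t] ⊆ S[t′] ⊆ (S[t])_𝔪`
  have hle₁ : (Algebra.adjoin S (t : Set E)).toSubring ≤ (Algebra.adjoin S (t' : Set E)).toSubring :=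
    fun x hx => Algebra.adjoin_mono (by exact_mod_cast htt') hx
  have hle₂ : (Algebra.adjoin S (t' : Set E)).toSubring ≤ L := by
    rw [Algebra.adjoin_eq_ring_closure]
    refine Subring.closure_le.mpr ?_
    rintro x (⟨s, rfl⟩ | hx)
    · exact le_locAtCentre _ OE (Subalgebra.algebraMap_mem _ s)
    · exact ht'L x (Finset.mem_coe.mp hx)
  have hTO' : (Algebra.adjoin S (t' : Set E)).toSubring ≤ OE.toSubring := hle₂.trans hLO
  have hloc : locAtCentre (Algebra.adjoin S (t' : Set E)).toSubring OE = L := by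
    apply le_antisymm
    · exact (locAtCentre_mono OE hle₂).trans (locAtCentre_locAtCentre _ OE).le
    · exact locAtCentre_mono OE hle₁
  refine ⟨t', ?_, ?_, hTO', ?_, ?_, ?_⟩
  · intro x hx
    obtain ⟨g, y, -, rfl⟩ := (ht' x).mp (Finset.mem_coe.mp hx)
    exact (g.1 y).2
  · exact hXcl.trans (Subfield.closure_mono (Set.union_subset_union_right _ (by exact_mod_cast htt')))
  · refine (isRegularLocalRing_locAtCentre_iff hTO').mp ?_
    rw [hloc]
    exact (isRegularLocalRing_locAtCentre_iff hTO).mpr hreg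
  · -- `t′` is `Gˢ`-stable
    intro τ hτ x hx
    obtain ⟨g, y, hy, hgy⟩ := (ht' (x : E)).mp hx
    have hx' : x = g.1 y := Subtype.ext hgy.symm
    refine (ht' _).mpr ⟨⟨τ * g.1, (decompositionGroupIn OE N).mul_mem hτ g.2⟩, y, hy, ?_⟩
    rw [hx', AlgEquiv.mul_apply]
  · -- trivial inertia of `Gˢ/Gⁱ`
    intro τ hτ
    rcases hI τ hτ with hτi | ⟨x, hx, hv⟩
    · left
      intro x hx
      obtain ⟨g, y, hy, hgy⟩ := (ht' (x : E)).mp hx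
      have hx' : x = g.1 y := Subtype.ext hgy.symm
      -- `g⁻¹ τ g ∈ Gⁱ` fixes `y ∈ Mⁱ`
      have hconj : g.1⁻¹ * τ * g.1⁻¹⁻¹ ∈ inertiaGroupIn OE N :=
        conj_mem_inertiaGroupIn OE N ((decompositionGroupIn OE N).inv_mem g.2) hτi
      rw [inv_inv] at hconj
      have hyfix := htfix (y : E) hy _ hconj y.2
      have hy' : (⟨(y : E), y.2⟩ : N) = y := Subtype.ext rfl
      rw [hy'] at hyfix
      rw [hx']
      calc τ (g.1 y) = g.1 ((g.1⁻¹ * τ * g.1) y) := by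
            rw [AlgEquiv.mul_apply, AlgEquiv.mul_apply, ← AlgEquiv.mul_apply g.1 g.1⁻¹,
              mul_inv_cancel, AlgEquiv.one_apply]
        _ = g.1 y := by rw [hyfix]
    · right
      refine ⟨x, ?_, hv⟩
      rw [hloc]
      exact hx

/-- **Cossart–Piltant 2019, Prop. 4.10 from Thm. 1.5, principalization, resolution of excellent
surfaces (embedded and non-embedded), "S is stable by G" in BOTH layers read on the LOCAL RING,
and the decomposition layer of [CoP1] Prop. 9.3.** The inertia-layer input is now `hStabIloc`:
for `N | M` finite Galois in the frame, `(LU Mⁱ)` can be realised by a model `S[t]`, `t ⊆ Mⁱ`,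
whose local ring `(S[t])_𝔪` is `Gˢ`-STABLE and on which every `τ ∈ Gˢ ∖ Gⁱ` moves some element
by a `v`-unit — the printed "the invariant ring `S₀ˢ := (S₀ⁱ)^{Gˢ/Gⁱ}` … `S₀ⁱ` is local-étale
over `S₀ˢ`" with its silent stability made explicit; the tame-layer input `hStabLoc` is the
analogous sentence "`S` is stable by `G`" of Lemma 9.4.
[cite: CossartPiltant2019, Props. 4.3, 4.4 and proof of Prop. 4.10 (arXiv v1: Props. 4.2, 4.3, 4.8, pp. 50–54)]
[cite: CossartPiltant2008, Lemma 9.4, Prop. 9.3, Prop. 9.5 (HAL pp. 26–30)]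
[cite: CossartJannsenSaito2020, Thm. 1.2, Cor. 1.5] -/
theorem cossartPiltant2019ReductionP_of_cjs_of_stableInertiaLocalRing
    (hloc : CossartPiltant2019Local.{u}) (h44 : CossartPiltant2019Principalization.{u})
    (hCJS : CossartJannsenSaito2020General.{u})
    (hEmb : ∀ (Z : Scheme.{u}) [IsIntegral Z] [IsNoetherian Z], Scheme.IsRegular Z →
      Scheme.IsExcellent Z → ∀ (X : Set Z), IsClosed X → X ≠ Set.univ → topologicalKrullDim X ≤ 2 →
        ∃ (Z' : Scheme.{u}) (π : Z' ⟶ Z), IsProper π ∧ Function.Surjective π.base ∧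
          (∃ U : Z.Opens, (U : Set Z) = Xᶜ ∧ IsIso (π ∣_ U)) ∧
          IsStrictNormalCrossingsDivisor Z' (π.base ⁻¹' X))
    (hStabLoc :
      ∀ (p : ℕ), p.Prime →
      ∀ (S : Type u) [CommRing S] [IsDomain S] [IsRegularLocalRing S],
        IsExcellentRing S → ringKrullDim S = 3 → CharP (ResidueField S) p →
        IsAdicComplete (maximalIdeal S) S →
      ∀ (E : Type u) [Field E] [Algebra S E], Function.Injective (algebraMap S E) →
        IsAlgClosed E → Algebra.IsAlgebraic S E →
      ∀ (OE : ValuationSubring E), (∀ s : S, algebraMap S E s ∈ OE) →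
        (∀ s ∈ maximalIdeal S, OE.valuation (algebraMap S E s) < 1) →
        (∀ y : OE, ∃ q : S[X], (∃ i, q.coeff i ∉ maximalIdeal S) ∧
          OE.valuation (q.eval₂ (algebraMap S E) y) < 1) →
      Nonempty OE.valuation.RankOne →
      ∀ (ℓ : ℕ), ℓ.Prime → ℓ ≠ p → ∀ (ζ : E), IsPrimitiveRoot ζ ℓ →
      ∀ (A : Subfield E), (∀ s : S, algebraMap S E s ∈ A) → ζ ∈ A →
      ∀ (θ : E), θ ∉ A → θ ^ ℓ ∈ A → OE.valuation θ ≤ 1 →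
        Module.finrank A (adjoin A ({θ} : Set E)) = ℓ → IsGalois A (adjoin A ({θ} : Set E)) →
        inertiaGroupIn OE (adjoin A ({θ} : Set E)) = ⊤ →
        (∃ t : Finset E, (t : Set E) ⊆ (adjoin A ({θ} : Set E)).toSubfield ∧
          (adjoin A ({θ} : Set E)).toSubfield ≤
            Subfield.closure (Set.range (algebraMap S E) ∪ (t : Set E)) ∧
          ∃ hTO : (Algebra.adjoin S (t : Set E)).toSubring ≤ OE.toSubring,
            IsRegularLocalRing (Localization.AtPrime
              (Ideal.comap (Subring.inclusion hTO) (maximalIdeal OE)))) →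
        (∃ t : Finset E, (t : Set E) ⊆ (adjoin A ({θ} : Set E)).toSubfield ∧
          (adjoin A ({θ} : Set E)).toSubfield ≤
            Subfield.closure (Set.range (algebraMap S E) ∪ (t : Set E)) ∧
          ∃ hTO : (Algebra.adjoin S (t : Set E)).toSubring ≤ OE.toSubring,
            IsRegularLocalRing (Localization.AtPrime
              (Ideal.comap (Subring.inclusion hTO) (maximalIdeal OE))) ∧
            ∀ (τ : adjoin A ({θ} : Set E) ≃ₐ[A] adjoin A ({θ} : Set E))
              (x : adjoin A ({θ} : Set E)),
              (x : E) ∈ locAtCentre (Algebra.adjoin S (t : Set E)).toSubring OE →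
              ((τ x : adjoin A ({θ} : Set E)) : E) ∈
                locAtCentre (Algebra.adjoin S (t : Set E)).toSubring OE))
    (hStabIloc :
      ∀ (p : ℕ), p.Prime →
      ∀ (S : Type u) [CommRing S] [IsDomain S] [IsRegularLocalRing S],
        IsExcellentRing S → ringKrullDim S = 3 → CharP (ResidueField S) p →
        IsAdicComplete (maximalIdeal S) S →
      ∀ (E : Type u) [Field E] [Algebra S E], Function.Injective (algebraMap S E) →
        IsAlgClosed E → Algebra.IsAlgebraic S E →
      ∀ (OE : ValuationSubring E), (∀ s : S, algebraMap S E s ∈ OE) →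
        (∀ s ∈ maximalIdeal S, OE.valuation (algebraMap S E s) < 1) →
        (∀ y : OE, ∃ q : S[X], (∃ i, q.coeff i ∉ maximalIdeal S) ∧
          OE.valuation (q.eval₂ (algebraMap S E) y) < 1) →
      Nonempty OE.valuation.RankOne →
      ∀ (M : Subfield E), (∀ s : S, algebraMap S E s ∈ M) →
      ∀ (N : IntermediateField M E) [FiniteDimensional M N] [IsGalois M N],
        (∃ t : Finset E, (t : Set E) ⊆ (lift (fixedField (inertiaGroupIn OE N))).toSubfield ∧
          (lift (fixedField (inertiaGroupIn OE N))).toSubfield ≤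
            Subfield.closure (Set.range (algebraMap S E) ∪ (t : Set E)) ∧
          ∃ hTO : (Algebra.adjoin S (t : Set E)).toSubring ≤ OE.toSubring,
            IsRegularLocalRing (Localization.AtPrime
              (Ideal.comap (Subring.inclusion hTO) (maximalIdeal OE)))) →
        ∃ t : Finset E, (t : Set E) ⊆ (lift (fixedField (inertiaGroupIn OE N))).toSubfield ∧
          (lift (fixedField (inertiaGroupIn OE N))).toSubfield ≤
            Subfield.closure (Set.range (algebraMap S E) ∪ (t : Set E)) ∧
          ∃ hTO : (Algebra.adjoin S (t : Set E)).toSubring ≤ OE.toSubring,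
            IsRegularLocalRing (Localization.AtPrime
              (Ideal.comap (Subring.inclusion hTO) (maximalIdeal OE))) ∧
            (∀ τ ∈ decompositionGroupIn OE N, ∀ x : N,
              (x : E) ∈ locAtCentre (Algebra.adjoin S (t : Set E)).toSubring OE →
              ((τ x : N) : E) ∈ locAtCentre (Algebra.adjoin S (t : Set E)).toSubring OE) ∧
            (∀ τ ∈ decompositionGroupIn OE N, τ ∈ inertiaGroupIn OE N ∨
              ∃ x : N, (x : E) ∈ locAtCentre (Algebra.adjoin S (t : Set E)).toSubring OE ∧
                OE.valuation (((τ x : N) : E) - x) = 1))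
    (hDec :
      ∀ (p : ℕ), p.Prime →
      ∀ (S : Type u) [CommRing S] [IsDomain S] [IsRegularLocalRing S],
        IsExcellentRing S → ringKrullDim S = 3 → CharP (ResidueField S) p →
        IsAdicComplete (maximalIdeal S) S →
      ∀ (E : Type u) [Field E] [Algebra S E], Function.Injective (algebraMap S E) →
        IsAlgClosed E → Algebra.IsAlgebraic S E →
      ∀ (OE : ValuationSubring E), (∀ s : S, algebraMap S E s ∈ OE) →
        (∀ s ∈ maximalIdeal S, OE.valuation (algebraMap S E s) < 1) →
        (∀ y : OE, ∃ q : S[X], (∃ i, q.coeff i ∉ maximalIdeal S) ∧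
          OE.valuation (q.eval₂ (algebraMap S E) y) < 1) →
      Nonempty OE.valuation.RankOne →
      ∀ (M : Subfield E), (∀ s : S, algebraMap S E s ∈ M) →
      ∀ (N : IntermediateField M E) [FiniteDimensional M N] [IsGalois M N] (K' : Subfield E),
        M ≤ K' → K' ≤ (lift (fixedField (decompositionGroupIn OE N))).toSubfield →
        (∃ t : Finset E, (t : Set E) ⊆ K' ∧
          K' ≤ Subfield.closure (Set.range (algebraMap S E) ∪ (t : Set E)) ∧
          ∃ hTO : (Algebra.adjoin S (t : Set E)).toSubring ≤ OE.toSubring,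
            IsRegularLocalRing (Localization.AtPrime
              (Ideal.comap (Subring.inclusion hTO) (maximalIdeal OE)))) →
        (∃ t : Finset E, (t : Set E) ⊆ M ∧
          M ≤ Subfield.closure (Set.range (algebraMap S E) ∪ (t : Set E)) ∧
          ∃ hTO : (Algebra.adjoin S (t : Set E)).toSubring ≤ OE.toSubring,
            IsRegularLocalRing (Localization.AtPrime
              (Ideal.comap (Subring.inclusion hTO) (maximalIdeal OE))))) :
    CossartPiltant2019ReductionP.{u} :=
  cossartPiltant2019ReductionP_of_cjs_of_stableInertiaField hloc h44 hCJS hEmb hStabLoc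
    (fun p hp S _ _ _ hS hSdim hSchar hScomp E _ _ hinj hE halg OE hSO hdom hres hrk M hSM N _ _
        hLUI => by
      obtain ⟨t, htI, hIcl, hTO, hreg, hstab, hI⟩ := hStabIloc p hp S hS hSdim hSchar hScomp E
        hinj hE halg OE hSO hdom hres hrk M hSM N hLUI
      exact exists_stableModel_of_stableLocalRing_decompositionGroup OE M N t htI
        (lift (fixedField (decompositionGroupIn OE N))).toSubfield
        ((lift_fixedField_toSubfield_mono (inertiaGroupIn_le_decompositionGroupIn OE N)).trans
          hIcl) hTO hreg hstab hI)
    hDec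

end InertiaStableLocalRing

end Literature.AlgebraicGeometry.Resolution

end
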